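import Literature.NumberTheory.Automorphic.Liu2021.Def411WeilCarriersLocalIsotypy
import Literature.NumberTheory.Automorphic.UnitaryGroupDualPairLocalLine
import Literature.RepresentationTheory.Liu2021.GlobalOscillatorIsomorphismCriterion
import HarnessLib

/-!
# [Liu2021, Def. 4.11 ∕ Thm. 4.18 (2)]: isomorphic `ω(μ, ε, χ)`'s have isomorphic LOCAL TYPES at every finite place — for the
# tree's CONSTRUCTED carriers `rhoAtLine`, from Lem. D.1 (1) AS PRINTED per place (the `n ≥ 3` restriction step of
# «Statement (2) follows from Lemma D.1», l. 2270)

Topic `NumberTheory/Automorphic/Liu2021`; namespace `Literature.NumberTheory.Automorphic.Liu2021.Def411WeilCarriers`.  KERNEL ONLY: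
theorems (no definition, no named fact, no `sorry`).  Sequel of `Def411WeilCarriersLocalIsotypy` §5 ∕ `Def411WeilCarriersLocalIsotypyAtPlace` (✔: for
EVERY `ι : G →* U(J_V)(𝔸_f)` and `φ' : U(J_V)(F_v) →* G` over the coordinate embedding `inclPlace v`, the `ℂ[U(J_V)(F_v)]`-module of
`rhoAtLine … ι a χ ∘ φ'` is ISOTYPIC of the local type `X_v(𝓢, a, χ) := Coinv(ω_v ∘ (u ↦ u·1_n), χ_v) ∘ (k ↦ k ⊗ 1)`, `ω_v = 𝓢.omegaLoc v`) and of
`Literature/RepresentationTheory/Liu2021/GlobalOscillatorIsomorphismCriterion.lean` (✔ `nonempty_equiv_of_isotypicComponent_eq_top`: a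
global equivalence of representations isotypic of irreducible local types forces an equivalence of the types — [FlathCorvallis1979, Thm. 3]
uniqueness clause ∕ [Bump1997, §3.4 Prop. 3.4.1]).

WHY (the Δ2 bridge's cite leg `hμsep`, cell pub-hodgecm2).  [Liu2021, Thm. 4.18 (2)] («mutually non-isomorphic», l. 2241) is proved by the
printed sentence «Statement (2) follows from Lemma D.1» (l. 2270): an isomorphism `ω(μ', ε', χ') ≃ ω(μ, ε, χ)` of `𝔾(𝔸_F^∞)`-modules restricts, at
every finite place `v`, to an isomorphism of the LOCAL oscillator representations `ω(μ'_v, ε'_v, χ'_v) ≃ ω(μ_v, ε_v, χ_v)` (Def. 4.11: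
`ω(μ, ε, χ) := ⊗'_v ω(μ_v, ε_v, χ_v)`), to which the local Lemma D.1 (3) (l. 5233) applies.  This file is the RESTRICTION STEP for the tree's
constructed carriers `Def411WeilCarriers.rhoAtLine … hs ι a χ` (`Def411WeilCarriersAtLine.lean`), with nothing of [Liu2021] assumed beyond
Lemma D.1, first sentence + (1), AS PRINTED per place (the displayed `hD1`, which makes the local types irreducible for `n ≥ 3`):

* `isIrreducible_localType_of_lemD1AsPrinted` — `X_v(𝓢, a, χ)` is irreducible: ✔ `LemD1OfPlace.isIrreducible_rep_of_lemD1_1AsPrinted` at the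
  pair's hermitian matrix `reindex e (J_V ⊗ J_W a)`, pulled back along the ONTO map `localLineInl v` (the `haveI` inside the prequel's proof,
  exposed as a theorem);
* `equivId_of_equiv` — bookkeeping: for `ι` onto, a `G`-equivariant linear equivalence between two carriers `rhoAtLine … ι a χ`,
  `rhoAtLine … ι a' χ'` is `U(J_V)(𝔸_f)`-equivariant (an `Equiv` of the carriers read through `MonoidHom.id`);
* **`nonempty_equiv_localTypes_of_equiv`** — THE RESTRICTION STEP: two systems of data `(s, a, χ, 𝓢, hfac, μ_•, hD1)` and
  `(s', a', χ', 𝓢', hfac', μ'_•, hD1')` over the same hermitian space `J_V` and the same `ι : G →* U(J_V)(𝔸_f)` (onto), `n ≥ 3`, a non-zero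
  carrier `ω ≠ 0` and a `G`-equivariant `ℂ`-linear equivalence `ω(s, a, χ) ≃ ω(s', a', χ')` give, at EVERY finite place `v`, an
  equivalence of local types `X_v(𝓢, a, χ) ≃ X_v(𝓢', a', χ')` as representations of `U(J_V)(F_v)`;
* `forall_localMu_eq_of_equiv_of_localSeparation` — the `hμsep`-shaped corollary modulo a per-place LOCAL separation statement in local-type
  currency («`X_v ≃ X'_v ⟹ μ_v = μ'_v`», which `Liu2021/Def411WeilCarriersLocalDataAtV.lean` derives from Lemma D.1 (3) AS PRINTED read on the
  indexed collection of the tree's local data): then `μ_v = μ'_v` at every `v`.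

HC_CM is NOT proved and not mentioned further; «Δ2 BRIDGE CLOSED» is NOT claimed; nothing about the model's Weil carriers is constructed here.
Cell pub-hodgecm2 (COR-CM), Δ2 BRIDGE cite leg `hμsep`; seat prover-pub-hodgecm2-b10-g69-0.

## References
* [Liu2021] Y. Liu, Camb. J. Math. 9 (2021) = arXiv:2102.11518: Def. 4.11 (l. 2083–2097), Thm. 4.18 (2) and its proof (l. 2241, 2270),
  App. D §D.1 Steps 1∕2∕3 (l. 5217∕5219∕5221), Lem. D.1 (l. 5226–5233; (1) l. 5229; (3) l. 5233).
* [FlathCorvallis1979] D. Flath, PSPM 33.1 (1979), Theorem 3 (uniqueness clause).  [Bump1997] D. Bump, CUP 1997, §3.4 Prop. 3.4.1.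
* [GelbartRogawski1991] S. Gelbart, J. Rogawski, Invent. Math. 105 (1991), §3.1 Prop. 3.1.1 p. 455 L1–3.
-/

set_option autoImplicit false

noncomputable section

open scoped Matrix Kronecker RestrictedProduct NumberField Classical
open NumberField IsDedekindDomain Filter Set
open Literature.NumberTheory Literature.NumberTheory.Automorphic Literature.NumberTheory.Automorphic.UnitaryGroup
open Literature.NumberTheory.GelbartRogawski1991 Literature.NumberTheory.GelbartRogawski1991.UnitaryDualPair
open Literature.NumberTheory.GelbartRogawski1991.UnitaryDualPair.WeilCoinv
open Literature.NumberTheory.Weil1964 Literature.RepresentationTheory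

namespace Literature.NumberTheory.Automorphic.Liu2021.Def411WeilCarriers

variable (F E : Type) [Field F] [NumberField F] [Field E] [NumberField E] [Algebra F E]
variable (c : E ≃ₐ[F] E) (N : ℕ) {n : ℕ} (e : Fin N × Fin 1 ≃ Fin n)
variable (JV : Matrix (Fin N) (Fin N) E) {TV : Matrix (Fin N) (Fin N) F}
variable [Algebra.IsQuadraticExtension F E] {δ : E} (hcδ : c δ = -δ) (hδ : δ ≠ 0) {d : F} (hd : δ * δ = algebraMap F E d)
/- (every further binder explicit per declaration — no section `variable` carrying a hypothesis, per the gate's D-0026 readout) -/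

/-! ## §1 The local type `X_v(𝓢, a, χ)` is irreducible (Lem. D.1 (1) AS PRINTED at `v`, `n ≥ 3`) -/

section LocalType

/-- **The local type `X_v(𝓢, a, χ) = Coinv(ω_v ∘ (u ↦ u·1_n), χ_v) ∘ (k ↦ k ⊗ 1)` of `U(J_V)(F_v)` is IRREDUCIBLE**, from [Liu2021, App. D
Lem. D.1, first sentence + (1)] AS PRINTED at the tree's local datum `localLemD1Data … a 𝓢 … μ … χ … v` and `n ≥ 3`: the maximal `χ_v`-quotient of
`ω_v` along the local centre is irreducible as a representation of `U(J_V ⊗ J_W a)(F_v)` (✔ `LemD1OfPlace.isIrreducible_rep_of_lemD1_1AsPrinted`), and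
`localLineInl v : U(J_V)(F_v) → U(J_V ⊗ J_W a)(F_v)` is onto for a line (✔ `localLineInl_surjective`).
[cite: Liu2021, App. D §D.1 Steps 1∕2∕3 (l. 5217∕5219∕5221), Lem. D.1 (l. 5227; (1) l. 5229)] -/
theorem isIrreducible_localType_of_lemD1AsPrinted (hV : TV.IsSymm) (hVd : IsUnit TV.det)
    (hJV : JV = TV.map (algebraMap F E)) (a : Fˣ) (χ : Chi F E c)
    (𝓢 : LocalSplitting.FinLocalSplittings F E c n hcδ hδ hd (gram F e TV (TW F a)) (isSymm_gram F e hV (isSymm_TW F a))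
      (reindex_kronecker_eq_gram_map F E e hJV (JW_eq F E a)))
    (hn : 3 ≤ n) (μ : ∀ v : HeightOneSpectrum (𝓞 F), (LocalRing E v)ˣ →* ℂˣ) (hμn : ∀ v x, ‖((μ v x : ℂˣ) : ℂ)‖ = 1)
    (hμc : ∀ v, Continuous fun x => ((μ v x : ℂˣ) : ℂ))
    (hμF : ∀ (v : HeightOneSpectrum (𝓞 F)) (t : (v.adicCompletion F)ˣ),
      μ v (Units.map (algebraMap (v.adicCompletion F) (LocalRing E v)).toMonoidHom t) = 1 ↔
        ∃ x : (LocalRing E v)ˣ, (x : LocalRing E v) * conjLocal E c v x =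
          algebraMap (v.adicCompletion F) (LocalRing E v) t)
    (hχn : ∀ u, ‖((χ.1 u : ℂˣ) : ℂ)‖ = 1) (v : HeightOneSpectrum (𝓞 F))
    (hD1 : LemD1_1AsPrinted (localLemD1Data F E c N e JV hcδ hδ hd hV hVd hJV a 𝓢 hn μ hμn hμc hμF χ.1 hχn χ.2.1 v)) :
    (show Representation ℂ (UnitaryGroup.localPi E c N JV v) _ from
      (TwistedCoinv.rep (localCharOfCenter F E c (JW F E a) (JW_apply_ne_zero F E a) χ.1 v) (𝓢.omegaLoc v)
        (commute_omegaLoc_localCenter F E c N e JV (JW F E a) hcδ hδ hd hV (isSymm_TW F a) hJV (JW_eq F E a)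
          (JW_apply_ne_zero F E a) 𝓢 v)).comp (UnitaryGroup.localLineInl E c N e JV (JW F E a) v)).IsIrreducible := by
  haveI hirr0 := LemD1OfPlace.isIrreducible_rep_of_lemD1_1AsPrinted E v c n (Matrix.reindex e e (JV ⊗ₖ JW F E a))
    hcδ hδ (Nat.le_of_succ_le hn) (reindex_kronecker_JW_hermitian F E c N e JV hV hJV a)
    (det_reindex_kronecker_JW_ne_zero F E N e JV hVd hJV a) (JW F E a) (𝓢.omegaLoc v) (μ v) (hμn v)
    (hμc v) (hμF v) (localCharOfCenter F E c (JW F E a) (JW_apply_ne_zero F E a) χ.1 v)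
    (norm_localCharOfCenter F E c (JW F E a) (JW_apply_ne_zero F E a) hχn v)
    (continuous_coe_localCharOfCenter F E c (JW F E a) (JW_apply_ne_zero F E a) χ.2.1 v)
    (JW_apply_ne_zero F E a)
    (commute_omegaLoc_localCenter F E c N e JV (JW F E a) hcδ hδ hd hV (isSymm_TW F a) hJV
      (JW_eq F E a) (JW_apply_ne_zero F E a) 𝓢 v)
    hD1 hn
  exact (Representation.isIrreducible_comp_iff_of_surjective _ _
    (UnitaryGroup.localLineInl_surjective E c N e JV (JW F E a) (JW_apply_ne_zero F E a) v)).2 hirr0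

end LocalType

/-! ## §2 A `G`-equivariant equivalence of two carriers, for `ι : G →* U(J_V)(𝔸_f)` onto, is `U(J_V)(𝔸_f)`-equivariant -/

section EquivId

/-- **Bookkeeping**: for `ι : G →* U(J_V)(𝔸_f)` ONTO, a `G`-equivariant `ℂ`-linear equivalence between the carriers `rhoAtLine … hs ι a χ` and
`rhoAtLine … hs' ι a' χ'` (two splitting families, two lines, two characters; one `J_V`, one `ι`) is an equivalence of the two carriers read on
`U(J_V)(𝔸_f)` itself (`ι := MonoidHom.id`): `rhoAtLine … ι a χ g = rhoVAtLine … a χ (ι g)`. [cite: Liu2021, Def. 4.11 (l. 2092–2096), App. C (l. 4624)] -/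
theorem nonempty_equivId_of_equiv (hV : TV.IsSymm) (hVd : IsUnit TV.det)
    (hJV : JV = TV.map (algebraMap F E))
    {s : ∀ a : Fˣ, UnitaryGroup.adelicPair F E c N 1 JV (JW F E a) →* adelicMpCont F (Fin n) (adelicGram F e TV (TW F a))}
    (hs : ∀ a : Fˣ, (splittingDatum F E c N 1 e JV (JW F E a) hcδ hδ hd hV (isSymm_TW F a) hVd (isUnit_det_TW F a) hJV
      (JW_eq F E a)).IsCompatible (s a))
    {s' : ∀ a : Fˣ, UnitaryGroup.adelicPair F E c N 1 JV (JW F E a) →* adelicMpCont F (Fin n) (adelicGram F e TV (TW F a))}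
    (hs' : ∀ a : Fˣ, (splittingDatum F E c N 1 e JV (JW F E a) hcδ hδ hd hV (isSymm_TW F a) hVd (isUnit_det_TW F a) hJV
      (JW_eq F E a)).IsCompatible (s' a))
    (a a' : Fˣ) (χ χ' : Chi F E c) {G : Type*} [Group G] {ι : G →* UnitaryGroup.finAdelic F E c N JV} (hι : Function.Surjective ι)
    (hst : ∃ f : omegaAtLine F E c N e JV hcδ hδ hd hV hVd hJV hs a χ ≃ₗ[ℂ] omegaAtLine F E c N e JV hcδ hδ hd hV hVd hJV hs' a' χ',
      ∀ (g : G) (x : omegaAtLine F E c N e JV hcδ hδ hd hV hVd hJV hs a χ),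
        f (rhoAtLine F E c N e JV hcδ hδ hd hV hVd hJV hs ι a χ g x) = rhoAtLine F E c N e JV hcδ hδ hd hV hVd hJV hs' ι a' χ' g (f x)) :
    Nonempty ((rhoAtLine F E c N e JV hcδ hδ hd hV hVd hJV hs (MonoidHom.id _) a χ).Equiv
      (rhoAtLine F E c N e JV hcδ hδ hd hV hVd hJV hs' (MonoidHom.id _) a' χ')) := by
  obtain ⟨f, hf⟩ := hst
  refine ⟨Representation.Equiv.mk f fun g' => LinearMap.ext fun x => ?_⟩
  obtain ⟨g, rfl⟩ := hι g'
  exact hf g x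

end EquivId

/-! ## §3 THE RESTRICTION STEP: isomorphic carriers have isomorphic local types at every finite place -/

section Restriction

/-- **THE RESTRICTION STEP of «Statement (2) follows from Lemma D.1» ([Liu2021] l. 2270) for the tree's constructed carriers, read on
`U(J_V)(𝔸_f)`, the irreducibility of the local types GIVEN** (instances; from Lem. D.1 (1) AS PRINTED by §1, or by any other route): an
equivalence `rhoAtLine … hs id a χ ≃ rhoAtLine … hs' id a' χ'` of a NON-ZERO carrier restricts, at every finite place `v` (coordinate embedding
`inclPlace v`; both restrictions are ISOTYPIC of their local types by ✔ `isotypicComponent_rhoAtLine_comp_eq_top_of_factors`), to an equivalence of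
the local types `X_v(𝓢, a, χ) ≃ X_v(𝓢', a', χ')` of `U(J_V)(F_v)` — ✔ `nonempty_equiv_of_isotypicComponent_eq_top` ([FlathCorvallis1979, Thm. 3]
uniqueness clause).  Inputs beyond the data: the local–global factorisations `hfac ∕ hfac'` through the local splittings (the survival clause of
Def. 4.11's `⊗'` is ✔ `survival_atLine`).
[cite: Liu2021, Def. 4.11 (l. 2092–2096), Thm. 4.18 (2) with proof l. 2270; FlathCorvallis1979, Theorem 3 (uniqueness clause); Bump1997, §3.4 Prop. 3.4.1; GelbartRogawski1991, §3.1 Prop. 3.1.1 p. 455 L1–3] -/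
theorem nonempty_equiv_localTypes_of_equivId_of_isIrreducible (hV : TV.IsSymm) (hVd : IsUnit TV.det)
    (hJV : JV = TV.map (algebraMap F E))
    {s : ∀ a : Fˣ, UnitaryGroup.adelicPair F E c N 1 JV (JW F E a) →* adelicMpCont F (Fin n) (adelicGram F e TV (TW F a))}
    (hs : ∀ a : Fˣ, (splittingDatum F E c N 1 e JV (JW F E a) hcδ hδ hd hV (isSymm_TW F a) hVd (isUnit_det_TW F a) hJV
      (JW_eq F E a)).IsCompatible (s a))
    {s' : ∀ a : Fˣ, UnitaryGroup.adelicPair F E c N 1 JV (JW F E a) →* adelicMpCont F (Fin n) (adelicGram F e TV (TW F a))}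
    (hs' : ∀ a : Fˣ, (splittingDatum F E c N 1 e JV (JW F E a) hcδ hδ hd hV (isSymm_TW F a) hVd (isUnit_det_TW F a) hJV
      (JW_eq F E a)).IsCompatible (s' a))
    (a : Fˣ) (χ : Chi F E c)
    (𝓢 : LocalSplitting.FinLocalSplittings F E c n hcδ hδ hd (gram F e TV (TW F a)) (isSymm_gram F e hV (isSymm_TW F a))
      (reindex_kronecker_eq_gram_map F E e hJV (JW_eq F E a)))
    (a' : Fˣ) (χ' : Chi F E c)
    (𝓢' : LocalSplitting.FinLocalSplittings F E c n hcδ hδ hd (gram F e TV (TW F a')) (isSymm_gram F e hV (isSymm_TW F a'))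
      (reindex_kronecker_eq_gram_map F E e hJV (JW_eq F E a')))
    (hfac : (pairSmall₁ F E c N 1 e JV (JW F E a) (s a)).comp (finPairToAdelic F E c N 1 JV (JW F E a)) =
      localRefSection F E c N 1 e JV (JW F E a) hcδ hδ hd hV (isSymm_TW F a) hJV (JW_eq F E a) 𝓢)
    (hfac' : (pairSmall₁ F E c N 1 e JV (JW F E a') (s' a')).comp (finPairToAdelic F E c N 1 JV (JW F E a')) =
      localRefSection F E c N 1 e JV (JW F E a') hcδ hδ hd hV (isSymm_TW F a') hJV (JW_eq F E a') 𝓢')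
    (hn : 3 ≤ n)
    [Nontrivial (omegaAtLine F E c N e JV hcδ hδ hd hV hVd hJV hs a χ)]
    (Eq : (rhoAtLine F E c N e JV hcδ hδ hd hV hVd hJV hs (MonoidHom.id _) a χ).Equiv
      (rhoAtLine F E c N e JV hcδ hδ hd hV hVd hJV hs' (MonoidHom.id _) a' χ'))
    (v : HeightOneSpectrum (𝓞 F))
    [hX : (show Representation ℂ (UnitaryGroup.localPi E c N JV v) _ from
        (TwistedCoinv.rep (localCharOfCenter F E c (JW F E a) (JW_apply_ne_zero F E a) χ.1 v) (𝓢.omegaLoc v)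
          (commute_omegaLoc_localCenter F E c N e JV (JW F E a) hcδ hδ hd hV (isSymm_TW F a) hJV (JW_eq F E a)
            (JW_apply_ne_zero F E a) 𝓢 v)).comp (UnitaryGroup.localLineInl E c N e JV (JW F E a) v)).IsIrreducible]
    [hX' : (show Representation ℂ (UnitaryGroup.localPi E c N JV v) _ from
        (TwistedCoinv.rep (localCharOfCenter F E c (JW F E a') (JW_apply_ne_zero F E a') χ'.1 v) (𝓢'.omegaLoc v)
          (commute_omegaLoc_localCenter F E c N e JV (JW F E a') hcδ hδ hd hV (isSymm_TW F a') hJV (JW_eq F E a')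
            (JW_apply_ne_zero F E a') 𝓢' v)).comp (UnitaryGroup.localLineInl E c N e JV (JW F E a') v)).IsIrreducible] :
    Nonempty ((show Representation ℂ (UnitaryGroup.localPi E c N JV v) _ from
        (TwistedCoinv.rep (localCharOfCenter F E c (JW F E a) (JW_apply_ne_zero F E a) χ.1 v) (𝓢.omegaLoc v)
          (commute_omegaLoc_localCenter F E c N e JV (JW F E a) hcδ hδ hd hV (isSymm_TW F a) hJV (JW_eq F E a)
            (JW_apply_ne_zero F E a) 𝓢 v)).comp (UnitaryGroup.localLineInl E c N e JV (JW F E a) v)).Equiv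
      (show Representation ℂ (UnitaryGroup.localPi E c N JV v) _ from
        (TwistedCoinv.rep (localCharOfCenter F E c (JW F E a') (JW_apply_ne_zero F E a') χ'.1 v) (𝓢'.omegaLoc v)
          (commute_omegaLoc_localCenter F E c N e JV (JW F E a') hcδ hδ hd hV (isSymm_TW F a') hJV (JW_eq F E a')
            (JW_apply_ne_zero F E a') 𝓢' v)).comp (UnitaryGroup.localLineInl E c N e JV (JW F E a') v))) := by
  haveI : NeZero n := ⟨by omega⟩
  exact Literature.RepresentationTheory.Liu2021.nonempty_equiv_of_isotypicComponent_eq_top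
    (UnitaryGroup.inclPlace F E c N JV v) Eq
    (isotypicComponent_rhoAtLine_comp_eq_top_of_factors F E c N e JV hcδ hδ hd hV hVd hJV hs a χ 𝓢
      (fun w => UnitaryGroup.localLineInl E c N e JV (JW F E a) w)
      (UnitaryGroup.eventually_localLineInl_mapsTo_localInt E c N e JV (JW F E a)) (MonoidHom.id _) hfac
      (survival_atLine F E c N e JV hcδ hδ hd hV hVd hJV a χ 𝓢) v (UnitaryGroup.inclPlace F E c N JV v) fun g =>
        UnitaryGroup.finAdelicEquiv_finPairEmb_inclPlace E c N e JV (JW F E a) v g)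
    (isotypicComponent_rhoAtLine_comp_eq_top_of_factors F E c N e JV hcδ hδ hd hV hVd hJV hs' a' χ' 𝓢'
      (fun w => UnitaryGroup.localLineInl E c N e JV (JW F E a') w)
      (UnitaryGroup.eventually_localLineInl_mapsTo_localInt E c N e JV (JW F E a')) (MonoidHom.id _) hfac'
      (survival_atLine F E c N e JV hcδ hδ hd hV hVd hJV a' χ' 𝓢') v (UnitaryGroup.inclPlace F E c N JV v) fun g =>
        UnitaryGroup.finAdelicEquiv_finPairEmb_inclPlace E c N e JV (JW F E a') v g)

/-- **THE RESTRICTION STEP of «Statement (2) follows from Lemma D.1» ([Liu2021] l. 2270) for the tree's constructed carriers, read on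
`U(J_V)(𝔸_f)`**: an equivalence `rhoAtLine … hs id a χ ≃ rhoAtLine … hs' id a' χ'` of a NON-ZERO carrier restricts, at every finite place `v`,
to an equivalence of the local types `X_v(𝓢, a, χ) ≃ X_v(𝓢', a', χ')` of `U(J_V)(F_v)`, the types being irreducible by [Lem. D.1 (1)] AS PRINTED
at both pair data (§1).  Inputs beyond the data: `hfac ∕ hfac'`, `n ≥ 3`, `hD1 ∕ hD1'` at every place.
[cite: Liu2021, Def. 4.11 (l. 2092–2096), Thm. 4.18 (2) with proof l. 2270, App. D Lem. D.1 (l. 5227; (1) l. 5229); FlathCorvallis1979, Theorem 3 (uniqueness clause); Bump1997, §3.4 Prop. 3.4.1] -/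
theorem nonempty_equiv_localTypes_of_equivId (hV : TV.IsSymm) (hVd : IsUnit TV.det)
    (hJV : JV = TV.map (algebraMap F E))
    {s : ∀ a : Fˣ, UnitaryGroup.adelicPair F E c N 1 JV (JW F E a) →* adelicMpCont F (Fin n) (adelicGram F e TV (TW F a))}
    (hs : ∀ a : Fˣ, (splittingDatum F E c N 1 e JV (JW F E a) hcδ hδ hd hV (isSymm_TW F a) hVd (isUnit_det_TW F a) hJV
      (JW_eq F E a)).IsCompatible (s a))
    {s' : ∀ a : Fˣ, UnitaryGroup.adelicPair F E c N 1 JV (JW F E a) →* adelicMpCont F (Fin n) (adelicGram F e TV (TW F a))}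
    (hs' : ∀ a : Fˣ, (splittingDatum F E c N 1 e JV (JW F E a) hcδ hδ hd hV (isSymm_TW F a) hVd (isUnit_det_TW F a) hJV
      (JW_eq F E a)).IsCompatible (s' a))
    (a : Fˣ) (χ : Chi F E c)
    (𝓢 : LocalSplitting.FinLocalSplittings F E c n hcδ hδ hd (gram F e TV (TW F a)) (isSymm_gram F e hV (isSymm_TW F a))
      (reindex_kronecker_eq_gram_map F E e hJV (JW_eq F E a)))
    (a' : Fˣ) (χ' : Chi F E c)
    (𝓢' : LocalSplitting.FinLocalSplittings F E c n hcδ hδ hd (gram F e TV (TW F a')) (isSymm_gram F e hV (isSymm_TW F a'))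
      (reindex_kronecker_eq_gram_map F E e hJV (JW_eq F E a')))
    (hfac : (pairSmall₁ F E c N 1 e JV (JW F E a) (s a)).comp (finPairToAdelic F E c N 1 JV (JW F E a)) =
      localRefSection F E c N 1 e JV (JW F E a) hcδ hδ hd hV (isSymm_TW F a) hJV (JW_eq F E a) 𝓢)
    (hfac' : (pairSmall₁ F E c N 1 e JV (JW F E a') (s' a')).comp (finPairToAdelic F E c N 1 JV (JW F E a')) =
      localRefSection F E c N 1 e JV (JW F E a') hcδ hδ hd hV (isSymm_TW F a') hJV (JW_eq F E a') 𝓢')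
    (hn : 3 ≤ n) (μ : ∀ v : HeightOneSpectrum (𝓞 F), (LocalRing E v)ˣ →* ℂˣ) (hμn : ∀ v x, ‖((μ v x : ℂˣ) : ℂ)‖ = 1)
    (hμc : ∀ v, Continuous fun x => ((μ v x : ℂˣ) : ℂ))
    (hμF : ∀ (v : HeightOneSpectrum (𝓞 F)) (t : (v.adicCompletion F)ˣ),
      μ v (Units.map (algebraMap (v.adicCompletion F) (LocalRing E v)).toMonoidHom t) = 1 ↔
        ∃ x : (LocalRing E v)ˣ, (x : LocalRing E v) * conjLocal E c v x =
          algebraMap (v.adicCompletion F) (LocalRing E v) t)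
    (μ' : ∀ v : HeightOneSpectrum (𝓞 F), (LocalRing E v)ˣ →* ℂˣ) (hμn' : ∀ v x, ‖((μ' v x : ℂˣ) : ℂ)‖ = 1)
    (hμc' : ∀ v, Continuous fun x => ((μ' v x : ℂˣ) : ℂ))
    (hμF' : ∀ (v : HeightOneSpectrum (𝓞 F)) (t : (v.adicCompletion F)ˣ),
      μ' v (Units.map (algebraMap (v.adicCompletion F) (LocalRing E v)).toMonoidHom t) = 1 ↔
        ∃ x : (LocalRing E v)ˣ, (x : LocalRing E v) * conjLocal E c v x =
          algebraMap (v.adicCompletion F) (LocalRing E v) t)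
    (hD1 : ∀ v, LemD1_1AsPrinted
      (localLemD1Data F E c N e JV hcδ hδ hd hV hVd hJV a 𝓢 hn μ hμn hμc hμF χ.1
        (norm_chi_eq_one F E c (Algebra.IsQuadraticExtension.finrank_eq_two F E)
          (UnitaryGroup.algEquiv_ne_one_of_apply_eq_neg F E c hcδ hδ) χ) χ.2.1 v))
    (hD1' : ∀ v, LemD1_1AsPrinted
      (localLemD1Data F E c N e JV hcδ hδ hd hV hVd hJV a' 𝓢' hn μ' hμn' hμc' hμF' χ'.1
        (norm_chi_eq_one F E c (Algebra.IsQuadraticExtension.finrank_eq_two F E)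
          (UnitaryGroup.algEquiv_ne_one_of_apply_eq_neg F E c hcδ hδ) χ') χ'.2.1 v))
    [Nontrivial (omegaAtLine F E c N e JV hcδ hδ hd hV hVd hJV hs a χ)]
    (Eq : (rhoAtLine F E c N e JV hcδ hδ hd hV hVd hJV hs (MonoidHom.id _) a χ).Equiv
      (rhoAtLine F E c N e JV hcδ hδ hd hV hVd hJV hs' (MonoidHom.id _) a' χ'))
    (v : HeightOneSpectrum (𝓞 F)) :
    Nonempty ((show Representation ℂ (UnitaryGroup.localPi E c N JV v) _ from
        (TwistedCoinv.rep (localCharOfCenter F E c (JW F E a) (JW_apply_ne_zero F E a) χ.1 v) (𝓢.omegaLoc v)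
          (commute_omegaLoc_localCenter F E c N e JV (JW F E a) hcδ hδ hd hV (isSymm_TW F a) hJV (JW_eq F E a)
            (JW_apply_ne_zero F E a) 𝓢 v)).comp (UnitaryGroup.localLineInl E c N e JV (JW F E a) v)).Equiv
      (show Representation ℂ (UnitaryGroup.localPi E c N JV v) _ from
        (TwistedCoinv.rep (localCharOfCenter F E c (JW F E a') (JW_apply_ne_zero F E a') χ'.1 v) (𝓢'.omegaLoc v)
          (commute_omegaLoc_localCenter F E c N e JV (JW F E a') hcδ hδ hd hV (isSymm_TW F a') hJV (JW_eq F E a')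
            (JW_apply_ne_zero F E a') 𝓢' v)).comp (UnitaryGroup.localLineInl E c N e JV (JW F E a') v))) := by
  haveI := isIrreducible_localType_of_lemD1AsPrinted F E c N e JV hcδ hδ hd hV hVd hJV a χ 𝓢 hn μ hμn hμc hμF
    (norm_chi_eq_one F E c (Algebra.IsQuadraticExtension.finrank_eq_two F E)
      (UnitaryGroup.algEquiv_ne_one_of_apply_eq_neg F E c hcδ hδ) χ) v (hD1 v)
  haveI := isIrreducible_localType_of_lemD1AsPrinted F E c N e JV hcδ hδ hd hV hVd hJV a' χ' 𝓢' hn μ' hμn' hμc' hμF'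
    (norm_chi_eq_one F E c (Algebra.IsQuadraticExtension.finrank_eq_two F E)
      (UnitaryGroup.algEquiv_ne_one_of_apply_eq_neg F E c hcδ hδ) χ') v (hD1' v)
  exact nonempty_equiv_localTypes_of_equivId_of_isIrreducible F E c N e JV hcδ hδ hd hV hVd hJV hs hs' a χ 𝓢 a' χ' 𝓢' hfac hfac' hn Eq v

/-- **THE RESTRICTION STEP, consumer form** (any `ι : G →* U(J_V)(𝔸_f)` ONTO — at the COR-CM pin the frame transport `ιVE V`, onto by
✔ `finPart_cmKTypeHom_finAdelicToAdelic_surjective`): a `G`-equivariant `ℂ`-linear equivalence `f` between the carriers `ω(s, a, χ) ≠ 0` and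
`ω(s', a', χ')` (the shape of the END's `hsep ∕ hμsep` hypothesis `hst`) gives, at every finite place `v`, an equivalence of the local types
`X_v(𝓢, a, χ) ≃ X_v(𝓢', a', χ')` of `U(J_V)(F_v)`.
[cite: Liu2021, Def. 4.11 (l. 2092–2096), Thm. 4.18 (2) with proof l. 2270, App. D Lem. D.1 (l. 5227; (1) l. 5229); FlathCorvallis1979, Theorem 3 (uniqueness clause)] -/
theorem nonempty_equiv_localTypes_of_equiv (hV : TV.IsSymm) (hVd : IsUnit TV.det)
    (hJV : JV = TV.map (algebraMap F E))
    {s : ∀ a : Fˣ, UnitaryGroup.adelicPair F E c N 1 JV (JW F E a) →* adelicMpCont F (Fin n) (adelicGram F e TV (TW F a))}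
    (hs : ∀ a : Fˣ, (splittingDatum F E c N 1 e JV (JW F E a) hcδ hδ hd hV (isSymm_TW F a) hVd (isUnit_det_TW F a) hJV
      (JW_eq F E a)).IsCompatible (s a))
    {s' : ∀ a : Fˣ, UnitaryGroup.adelicPair F E c N 1 JV (JW F E a) →* adelicMpCont F (Fin n) (adelicGram F e TV (TW F a))}
    (hs' : ∀ a : Fˣ, (splittingDatum F E c N 1 e JV (JW F E a) hcδ hδ hd hV (isSymm_TW F a) hVd (isUnit_det_TW F a) hJV
      (JW_eq F E a)).IsCompatible (s' a))
    (a : Fˣ) (χ : Chi F E c)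
    (𝓢 : LocalSplitting.FinLocalSplittings F E c n hcδ hδ hd (gram F e TV (TW F a)) (isSymm_gram F e hV (isSymm_TW F a))
      (reindex_kronecker_eq_gram_map F E e hJV (JW_eq F E a)))
    (a' : Fˣ) (χ' : Chi F E c)
    (𝓢' : LocalSplitting.FinLocalSplittings F E c n hcδ hδ hd (gram F e TV (TW F a')) (isSymm_gram F e hV (isSymm_TW F a'))
      (reindex_kronecker_eq_gram_map F E e hJV (JW_eq F E a')))
    (hfac : (pairSmall₁ F E c N 1 e JV (JW F E a) (s a)).comp (finPairToAdelic F E c N 1 JV (JW F E a)) =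
      localRefSection F E c N 1 e JV (JW F E a) hcδ hδ hd hV (isSymm_TW F a) hJV (JW_eq F E a) 𝓢)
    (hfac' : (pairSmall₁ F E c N 1 e JV (JW F E a') (s' a')).comp (finPairToAdelic F E c N 1 JV (JW F E a')) =
      localRefSection F E c N 1 e JV (JW F E a') hcδ hδ hd hV (isSymm_TW F a') hJV (JW_eq F E a') 𝓢')
    (hn : 3 ≤ n) (μ : ∀ v : HeightOneSpectrum (𝓞 F), (LocalRing E v)ˣ →* ℂˣ) (hμn : ∀ v x, ‖((μ v x : ℂˣ) : ℂ)‖ = 1)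
    (hμc : ∀ v, Continuous fun x => ((μ v x : ℂˣ) : ℂ))
    (hμF : ∀ (v : HeightOneSpectrum (𝓞 F)) (t : (v.adicCompletion F)ˣ),
      μ v (Units.map (algebraMap (v.adicCompletion F) (LocalRing E v)).toMonoidHom t) = 1 ↔
        ∃ x : (LocalRing E v)ˣ, (x : LocalRing E v) * conjLocal E c v x =
          algebraMap (v.adicCompletion F) (LocalRing E v) t)
    (μ' : ∀ v : HeightOneSpectrum (𝓞 F), (LocalRing E v)ˣ →* ℂˣ) (hμn' : ∀ v x, ‖((μ' v x : ℂˣ) : ℂ)‖ = 1)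
    (hμc' : ∀ v, Continuous fun x => ((μ' v x : ℂˣ) : ℂ))
    (hμF' : ∀ (v : HeightOneSpectrum (𝓞 F)) (t : (v.adicCompletion F)ˣ),
      μ' v (Units.map (algebraMap (v.adicCompletion F) (LocalRing E v)).toMonoidHom t) = 1 ↔
        ∃ x : (LocalRing E v)ˣ, (x : LocalRing E v) * conjLocal E c v x =
          algebraMap (v.adicCompletion F) (LocalRing E v) t)
    (hD1 : ∀ v, LemD1_1AsPrinted
      (localLemD1Data F E c N e JV hcδ hδ hd hV hVd hJV a 𝓢 hn μ hμn hμc hμF χ.1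
        (norm_chi_eq_one F E c (Algebra.IsQuadraticExtension.finrank_eq_two F E)
          (UnitaryGroup.algEquiv_ne_one_of_apply_eq_neg F E c hcδ hδ) χ) χ.2.1 v))
    (hD1' : ∀ v, LemD1_1AsPrinted
      (localLemD1Data F E c N e JV hcδ hδ hd hV hVd hJV a' 𝓢' hn μ' hμn' hμc' hμF' χ'.1
        (norm_chi_eq_one F E c (Algebra.IsQuadraticExtension.finrank_eq_two F E)
          (UnitaryGroup.algEquiv_ne_one_of_apply_eq_neg F E c hcδ hδ) χ') χ'.2.1 v))
    {G : Type*} [Group G] {ι : G →* UnitaryGroup.finAdelic F E c N JV} (hι : Function.Surjective ι)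
    (hnt : Nontrivial (omegaAtLine F E c N e JV hcδ hδ hd hV hVd hJV hs a χ))
    (hst : ∃ f : omegaAtLine F E c N e JV hcδ hδ hd hV hVd hJV hs a χ ≃ₗ[ℂ] omegaAtLine F E c N e JV hcδ hδ hd hV hVd hJV hs' a' χ',
      ∀ (g : G) (x : omegaAtLine F E c N e JV hcδ hδ hd hV hVd hJV hs a χ),
        f (rhoAtLine F E c N e JV hcδ hδ hd hV hVd hJV hs ι a χ g x) = rhoAtLine F E c N e JV hcδ hδ hd hV hVd hJV hs' ι a' χ' g (f x))
    (v : HeightOneSpectrum (𝓞 F)) :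
    Nonempty ((show Representation ℂ (UnitaryGroup.localPi E c N JV v) _ from
        (TwistedCoinv.rep (localCharOfCenter F E c (JW F E a) (JW_apply_ne_zero F E a) χ.1 v) (𝓢.omegaLoc v)
          (commute_omegaLoc_localCenter F E c N e JV (JW F E a) hcδ hδ hd hV (isSymm_TW F a) hJV (JW_eq F E a)
            (JW_apply_ne_zero F E a) 𝓢 v)).comp (UnitaryGroup.localLineInl E c N e JV (JW F E a) v)).Equiv
      (show Representation ℂ (UnitaryGroup.localPi E c N JV v) _ from
        (TwistedCoinv.rep (localCharOfCenter F E c (JW F E a') (JW_apply_ne_zero F E a') χ'.1 v) (𝓢'.omegaLoc v)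
          (commute_omegaLoc_localCenter F E c N e JV (JW F E a') hcδ hδ hd hV (isSymm_TW F a') hJV (JW_eq F E a')
            (JW_apply_ne_zero F E a') 𝓢' v)).comp (UnitaryGroup.localLineInl E c N e JV (JW F E a') v))) := by
  haveI := hnt
  obtain ⟨Eq⟩ := nonempty_equivId_of_equiv F E c N e JV hcδ hδ hd hV hVd hJV hs hs' a a' χ χ' hι hst
  exact nonempty_equiv_localTypes_of_equivId F E c N e JV hcδ hδ hd hV hVd hJV hs hs' a χ 𝓢 a' χ' 𝓢' hfac hfac' hn μ hμn hμc hμF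
    μ' hμn' hμc' hμF' hD1 hD1' Eq v

/-- **The `hμsep`-shaped corollary modulo a per-place LOCAL separation of `μ`** (Lem. D.1 (3)'s `μ`-clause in local-type currency, hypothesis
`hsepv`; supplied from [Lem. D.1 (3)] AS PRINTED read on the tree's indexed local data by `Def411WeilCarriersLocalDataAtV`): a `G`-equivariant
linear equivalence between `ω(s, a, χ) ≠ 0` and `ω(s', a', χ')` forces `μ_v = μ'_v` at EVERY finite place `v` («`μ = ⊗ μ_v`», Def. 4.11).
[cite: Liu2021, Def. 4.11 (l. 2086, 2092–2096), Thm. 4.18 (2) with proof l. 2270, App. D Lem. D.1 (1), (3) (l. 5229, 5233)] -/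
theorem forall_localMu_eq_of_equiv_of_localSeparation (hV : TV.IsSymm) (hVd : IsUnit TV.det)
    (hJV : JV = TV.map (algebraMap F E))
    {s : ∀ a : Fˣ, UnitaryGroup.adelicPair F E c N 1 JV (JW F E a) →* adelicMpCont F (Fin n) (adelicGram F e TV (TW F a))}
    (hs : ∀ a : Fˣ, (splittingDatum F E c N 1 e JV (JW F E a) hcδ hδ hd hV (isSymm_TW F a) hVd (isUnit_det_TW F a) hJV
      (JW_eq F E a)).IsCompatible (s a))
    {s' : ∀ a : Fˣ, UnitaryGroup.adelicPair F E c N 1 JV (JW F E a) →* adelicMpCont F (Fin n) (adelicGram F e TV (TW F a))}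
    (hs' : ∀ a : Fˣ, (splittingDatum F E c N 1 e JV (JW F E a) hcδ hδ hd hV (isSymm_TW F a) hVd (isUnit_det_TW F a) hJV
      (JW_eq F E a)).IsCompatible (s' a))
    (a : Fˣ) (χ : Chi F E c)
    (𝓢 : LocalSplitting.FinLocalSplittings F E c n hcδ hδ hd (gram F e TV (TW F a)) (isSymm_gram F e hV (isSymm_TW F a))
      (reindex_kronecker_eq_gram_map F E e hJV (JW_eq F E a)))
    (a' : Fˣ) (χ' : Chi F E c)
    (𝓢' : LocalSplitting.FinLocalSplittings F E c n hcδ hδ hd (gram F e TV (TW F a')) (isSymm_gram F e hV (isSymm_TW F a'))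
      (reindex_kronecker_eq_gram_map F E e hJV (JW_eq F E a')))
    (hfac : (pairSmall₁ F E c N 1 e JV (JW F E a) (s a)).comp (finPairToAdelic F E c N 1 JV (JW F E a)) =
      localRefSection F E c N 1 e JV (JW F E a) hcδ hδ hd hV (isSymm_TW F a) hJV (JW_eq F E a) 𝓢)
    (hfac' : (pairSmall₁ F E c N 1 e JV (JW F E a') (s' a')).comp (finPairToAdelic F E c N 1 JV (JW F E a')) =
      localRefSection F E c N 1 e JV (JW F E a') hcδ hδ hd hV (isSymm_TW F a') hJV (JW_eq F E a') 𝓢')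
    (hn : 3 ≤ n) (μ : ∀ v : HeightOneSpectrum (𝓞 F), (LocalRing E v)ˣ →* ℂˣ) (hμn : ∀ v x, ‖((μ v x : ℂˣ) : ℂ)‖ = 1)
    (hμc : ∀ v, Continuous fun x => ((μ v x : ℂˣ) : ℂ))
    (hμF : ∀ (v : HeightOneSpectrum (𝓞 F)) (t : (v.adicCompletion F)ˣ),
      μ v (Units.map (algebraMap (v.adicCompletion F) (LocalRing E v)).toMonoidHom t) = 1 ↔
        ∃ x : (LocalRing E v)ˣ, (x : LocalRing E v) * conjLocal E c v x =
          algebraMap (v.adicCompletion F) (LocalRing E v) t)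
    (μ' : ∀ v : HeightOneSpectrum (𝓞 F), (LocalRing E v)ˣ →* ℂˣ) (hμn' : ∀ v x, ‖((μ' v x : ℂˣ) : ℂ)‖ = 1)
    (hμc' : ∀ v, Continuous fun x => ((μ' v x : ℂˣ) : ℂ))
    (hμF' : ∀ (v : HeightOneSpectrum (𝓞 F)) (t : (v.adicCompletion F)ˣ),
      μ' v (Units.map (algebraMap (v.adicCompletion F) (LocalRing E v)).toMonoidHom t) = 1 ↔
        ∃ x : (LocalRing E v)ˣ, (x : LocalRing E v) * conjLocal E c v x =
          algebraMap (v.adicCompletion F) (LocalRing E v) t)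
    (hD1 : ∀ v, LemD1_1AsPrinted
      (localLemD1Data F E c N e JV hcδ hδ hd hV hVd hJV a 𝓢 hn μ hμn hμc hμF χ.1
        (norm_chi_eq_one F E c (Algebra.IsQuadraticExtension.finrank_eq_two F E)
          (UnitaryGroup.algEquiv_ne_one_of_apply_eq_neg F E c hcδ hδ) χ) χ.2.1 v))
    (hD1' : ∀ v, LemD1_1AsPrinted
      (localLemD1Data F E c N e JV hcδ hδ hd hV hVd hJV a' 𝓢' hn μ' hμn' hμc' hμF' χ'.1
        (norm_chi_eq_one F E c (Algebra.IsQuadraticExtension.finrank_eq_two F E)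
          (UnitaryGroup.algEquiv_ne_one_of_apply_eq_neg F E c hcδ hδ) χ') χ'.2.1 v))
    {G : Type*} [Group G] {ι : G →* UnitaryGroup.finAdelic F E c N JV} (hι : Function.Surjective ι)
    (hsepv : ∀ v : HeightOneSpectrum (𝓞 F),
      Nonempty ((show Representation ℂ (UnitaryGroup.localPi E c N JV v) _ from
          (TwistedCoinv.rep (localCharOfCenter F E c (JW F E a) (JW_apply_ne_zero F E a) χ.1 v) (𝓢.omegaLoc v)
            (commute_omegaLoc_localCenter F E c N e JV (JW F E a) hcδ hδ hd hV (isSymm_TW F a) hJV (JW_eq F E a)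
              (JW_apply_ne_zero F E a) 𝓢 v)).comp (UnitaryGroup.localLineInl E c N e JV (JW F E a) v)).Equiv
        (show Representation ℂ (UnitaryGroup.localPi E c N JV v) _ from
          (TwistedCoinv.rep (localCharOfCenter F E c (JW F E a') (JW_apply_ne_zero F E a') χ'.1 v) (𝓢'.omegaLoc v)
            (commute_omegaLoc_localCenter F E c N e JV (JW F E a') hcδ hδ hd hV (isSymm_TW F a') hJV (JW_eq F E a')
              (JW_apply_ne_zero F E a') 𝓢' v)).comp (UnitaryGroup.localLineInl E c N e JV (JW F E a') v))) →
      μ v = μ' v)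
    (hnt : Nontrivial (omegaAtLine F E c N e JV hcδ hδ hd hV hVd hJV hs a χ))
    (hst : ∃ f : omegaAtLine F E c N e JV hcδ hδ hd hV hVd hJV hs a χ ≃ₗ[ℂ] omegaAtLine F E c N e JV hcδ hδ hd hV hVd hJV hs' a' χ',
      ∀ (g : G) (x : omegaAtLine F E c N e JV hcδ hδ hd hV hVd hJV hs a χ),
        f (rhoAtLine F E c N e JV hcδ hδ hd hV hVd hJV hs ι a χ g x) = rhoAtLine F E c N e JV hcδ hδ hd hV hVd hJV hs' ι a' χ' g (f x))
    (v : HeightOneSpectrum (𝓞 F)) : μ v = μ' v :=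
  hsepv v (nonempty_equiv_localTypes_of_equiv F E c N e JV hcδ hδ hd hV hVd hJV hs hs' a χ 𝓢 a' χ' 𝓢' hfac hfac' hn μ hμn hμc hμF
    μ' hμn' hμc' hμF' hD1 hD1' hι hnt hst v)

end Restriction

end Literature.NumberTheory.Automorphic.Liu2021.Def411WeilCarriers

end
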